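import Summits.AtomisticToContinuum.Crystallization.Theorems.FreeSplittingCertificatesRadiusLadderRecurrence
import Summits.AtomisticToContinuum.Crystallization.Theorems.FreeSplittingCertificatesRadiusLadderPeriodicHalf

/-!
# Free-splitting certificates — key-disjoint sub-zoos glue (the rule LP decomposes over shared keys)

Support for crux `FreeSplittingCertificates.FiniteRangeSplitting` (item `stmt-AtomisticToContinuum-12559`),
continuing `…RadiusLadderRecurrence` (no refutation without recurrence) and `…RadiusLadderPeriodicHalf`
(periodic fragments never refute).  VALUE = a theorem about the finite LP falsifier of the radius ladder
`RungAt δ R`, NOT summit progress: nothing here decides a route item.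

Recall: a finite zoo `Z` REFUTES the rung at radius `R` when no pair-splitting rule is feasible at every site
of every configuration of `Z` (`not_rungAt_of_zoo`); the weighted site energy `siteE R Φ x i` reads the rule
only at the REALISED KEYS `zkey R (c,i,j) = (x_j - x_i, bondPattern R x i j)` of the ordered bonds at `i`
(`perturbative_siteE_eq`), and the realised key set of a zoo is closed under the complementarity involution
`Key.conj` (`zkey_rev`).  Hence the only coupling between two sub-zoos is through SHARED realised keys:

* `zkeys R Z` — the realised key set of a zoo (`conj`-closed: `conj_mem_zkeys_iff`; monotone; additive over
  unions `zkeys_union`); `siteE_congr_of_eqOn` — two rules agreeing on the keys realised at a site give the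
  same weighted site energy.
* `exists_feasibleOn_union_of_disjoint_zkeys` — **KEY-DISJOINT SUB-ZOOS GLUE**: if `Φ₁` is a rule feasible on
  `Z₁`, `Φ₂` a rule feasible on `Z₂`, and `zkeys R Z₁ ∩ zkeys R Z₂ = ∅`, then `Φ := Φ₁` on `zkeys R Z₁`,
  `Φ₂` elsewhere, is a rule feasible on `Z₁ ∪ Z₂` (complementarity survives because `zkeys R Z₁` is
  `conj`-closed).  `exists_feasibleOn_biUnion_of_pairwise_disjoint_zkeys` — the same for finitely many
  pairwise key-disjoint sub-zoos.
* `refuting_or_of_refuting_union` — **REFUTATIONS LOCALISE**: a refuting zoo split into two key-disjoint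
  parts has a refuting part; so a minimal refuting zoo is key-connected, and adding key-disjoint material to
  a non-refuting zoo never produces a refutation.
* `exists_feasibleOn_union_recurrenceFree` / `not_refuting_of_periodic_union_recurrenceFree` — the two retired
  families combine: a zoo made of finite fragments of attractive site-homogeneous periodic configurations
  (half rule, `halfRule_feasibleOn_periodic`) together with recurrence-free injective "defect" configurations
  (`exists_feasibleOn_of_recurrenceFree`) NEVER refutes, at any radius, as long as no defect bond realises a
  key of the periodic part.  What can refute a rung is therefore exactly a zoo in which some realised key of
  an under-bound row recurs in another row (RESULTS-R2 §6 P4/P6: "matched recurrence"), and nothing less.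

All statements are over `eInf` (unconditional; no reference-energy convention).
-/

noncomputable section
namespace Summit.AtomisticToContinuum.Crystallization.Theorems.StrictSplittingRuleBirth

open scoped BigOperators Classical
open Literature.MathematicalPhysics.StatisticalMechanics

/-- Euclidean `3`-space. -/
local notation "E3" => EuclideanSpace ℝ (Fin 3)

/-! ## Realised key sets -/

/-- The realised key set of a zoo at radius `R`: the keys `(x_j - x_i, bondPattern R x i j)` of its ordered
bonds. [folklore] -/
def zkeys (R : ℝ) (Z : Finset Conf) : Finset Key := (zbonds Z).image (zkey R)

/-- Membership in `zkeys`. -/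
theorem mem_zkeys {R : ℝ} {Z : Finset Conf} {k : Key} : k ∈ zkeys R Z ↔ ∃ b ∈ zbonds Z, zkey R b = k := by
  simp only [zkeys, Finset.mem_image]

/-- The key of a bond of the zoo is realised. -/
theorem zkey_mem_zkeys {R : ℝ} {Z : Finset Conf} {b : Bond} (hb : b ∈ zbonds Z) : zkey R b ∈ zkeys R Z :=
  mem_zkeys.2 ⟨b, hb, rfl⟩

/-- The key `(x_j - x_i, T_ij)` of the ordered bond `(c, i, j)`, `c ∈ Z`, `i ≠ j`, is realised (the form in which
`siteE` presents it). -/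
theorem pair_mem_zkeys {R : ℝ} {Z : Finset Conf} {c : Conf} (hc : c ∈ Z) {i j : Fin c.1} (hij : i ≠ j) :
    ((c.2 j - c.2 i, bondPattern R c.2 i j) : Key) ∈ zkeys R Z :=
  zkey_mem_zkeys (b := ⟨c, (i, j)⟩) (mem_zbonds.2 ⟨hc, hij⟩)

/-- Realised key sets are closed under the complementarity involution (bond reversal, `zkey_rev`). -/
theorem conj_mem_zkeys {R : ℝ} {Z : Finset Conf} {k : Key} (hk : k ∈ zkeys R Z) : k.conj ∈ zkeys R Z := by
  obtain ⟨b, hb, rfl⟩ := mem_zkeys.1 hk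
  rw [← zkey_rev]
  exact zkey_mem_zkeys (rev_mem_zbonds hb)

/-- `conj`-closedness as an `iff`. -/
theorem conj_mem_zkeys_iff {R : ℝ} {Z : Finset Conf} {k : Key} : k.conj ∈ zkeys R Z ↔ k ∈ zkeys R Z :=
  ⟨fun h => by simpa only [Key.conj_conj] using conj_mem_zkeys h, conj_mem_zkeys⟩

/-- `zkeys` is monotone in the zoo. -/
theorem zkeys_mono {R : ℝ} {Z Z' : Finset Conf} (h : Z ⊆ Z') : zkeys R Z ⊆ zkeys R Z' := by
  intro k hk
  obtain ⟨b, hb, rfl⟩ := mem_zkeys.1 hk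
  obtain ⟨hc, hij⟩ := mem_zbonds.1 hb
  exact zkey_mem_zkeys (mem_zbonds.2 ⟨h hc, hij⟩)

/-- `zkeys` of a union. -/
theorem zkeys_union {R : ℝ} (Z₁ Z₂ : Finset Conf) : zkeys R (Z₁ ∪ Z₂) = zkeys R Z₁ ∪ zkeys R Z₂ := by
  ext k
  simp only [mem_zkeys, mem_zbonds, Finset.mem_union]
  constructor
  · rintro ⟨b, ⟨hc | hc, hij⟩, hk⟩
    · exact Or.inl ⟨b, ⟨hc, hij⟩, hk⟩
    · exact Or.inr ⟨b, ⟨hc, hij⟩, hk⟩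
  · rintro (⟨b, ⟨hc, hij⟩, hk⟩ | ⟨b, ⟨hc, hij⟩, hk⟩)
    · exact ⟨b, ⟨Or.inl hc, hij⟩, hk⟩
    · exact ⟨b, ⟨Or.inr hc, hij⟩, hk⟩

/-- `zkeys` of an indexed union is covered by the members' key sets. -/
theorem mem_zkeys_biUnion {R : ℝ} {ι : Type*} {s : Finset ι} {Zf : ι → Finset Conf} {k : Key}
    (hk : k ∈ zkeys R (s.biUnion Zf)) : ∃ a ∈ s, k ∈ zkeys R (Zf a) := by
  obtain ⟨b, hb, rfl⟩ := mem_zkeys.1 hk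
  obtain ⟨hc, hij⟩ := mem_zbonds.1 hb
  obtain ⟨a, ha, hca⟩ := Finset.mem_biUnion.1 hc
  exact ⟨a, ha, zkey_mem_zkeys (mem_zbonds.2 ⟨hca, hij⟩)⟩

/-- **Locality of the site row**: two rules that agree on the keys realised at site `i` of `x` give the same
weighted site energy there. -/
theorem siteE_congr_of_eqOn {R : ℝ} {Φ Ψ : E3 → Finset E3 → ℝ} {N : ℕ} (x : Fin N → E3) (i : Fin N)
    (h : ∀ j : Fin N, j ≠ i → Φ (x j - x i) (bondPattern R x i j) = Ψ (x j - x i) (bondPattern R x i j)) :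
    siteE R Φ x i = siteE R Ψ x i := by
  rw [perturbative_siteE_eq, perturbative_siteE_eq]
  refine Finset.sum_congr rfl fun j hj => ?_
  rw [h j (Finset.ne_of_mem_erase hj)]

/-! ## Key-disjoint sub-zoos glue -/

/-- **Key-disjoint sub-zoos glue.**  Rules feasible on two sub-zoos with disjoint realised key sets glue into
one rule feasible on the union: take `Φ₁` on the keys of `Z₁` and `Φ₂` everywhere else.  The glued function
is a rule because `zkeys R Z₁` is closed under `Key.conj`, and each site row of `Z₁` (resp. `Z₂`) reads only
keys of `Z₁` (resp. only keys of `Z₂`, which avoid `zkeys R Z₁`). -/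
theorem exists_feasibleOn_union_of_disjoint_zkeys (R : ℝ) {Z₁ Z₂ : Finset Conf}
    {Φ₁ Φ₂ : E3 → Finset E3 → ℝ} (hΦ₁ : IsRule Φ₁) (hΦ₂ : IsRule Φ₂)
    (h₁ : ∀ c ∈ Z₁, ∀ i : Fin c.1, eInf ≤ siteE R Φ₁ c.2 i)
    (h₂ : ∀ c ∈ Z₂, ∀ i : Fin c.1, eInf ≤ siteE R Φ₂ c.2 i)
    (hdis : Disjoint (zkeys R Z₁) (zkeys R Z₂)) :
    ∃ Φ : E3 → Finset E3 → ℝ, IsRule Φ ∧ ∀ c ∈ Z₁ ∪ Z₂, ∀ i : Fin c.1, eInf ≤ siteE R Φ c.2 i := by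
  classical
  let Φ : E3 → Finset E3 → ℝ := fun v T => if ((v, T) : Key) ∈ zkeys R Z₁ then Φ₁ v T else Φ₂ v T
  have hin : ∀ v T, ((v, T) : Key) ∈ zkeys R Z₁ → Φ v T = Φ₁ v T := fun v T h => by
    simp only [Φ, if_pos h]
  have hout : ∀ v T, ((v, T) : Key) ∉ zkeys R Z₁ → Φ v T = Φ₂ v T := fun v T h => by
    simp only [Φ, if_neg h]
  refine ⟨Φ, ⟨fun v T => ?_, fun v T hv => ?_⟩, ?_⟩
  · -- box
    by_cases h : ((v, T) : Key) ∈ zkeys R Z₁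
    · rw [hin v T h]
      exact hΦ₁.1 v T
    · rw [hout v T h]
      exact hΦ₂.1 v T
  · -- complementarity: the partner key `(-v, T - v) = conj (v, T)` lies in `zkeys R Z₁` iff `(v, T)` does
    have hc : ((-v, T.image fun u => u - v) : Key) = Key.conj (v, T) := rfl
    by_cases h : ((v, T) : Key) ∈ zkeys R Z₁
    · have h' : ((-v, T.image fun u => u - v) : Key) ∈ zkeys R Z₁ := by
        rw [hc]
        exact conj_mem_zkeys h
      rw [hin v T h, hin _ _ h']
      exact hΦ₁.2 v T hv
    · have h' : ((-v, T.image fun u => u - v) : Key) ∉ zkeys R Z₁ := by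
        rw [hc, conj_mem_zkeys_iff]
        exact h
      rw [hout v T h, hout _ _ h']
      exact hΦ₂.2 v T hv
  · -- feasibility, row by row
    intro c hc i
    rcases Finset.mem_union.1 hc with hc₁ | hc₂
    · have heq : siteE R Φ c.2 i = siteE R Φ₁ c.2 i :=
        siteE_congr_of_eqOn c.2 i fun j hj => hin _ _ (pair_mem_zkeys hc₁ hj.symm)
      rw [heq]
      exact h₁ c hc₁ i
    · have heq : siteE R Φ c.2 i = siteE R Φ₂ c.2 i :=
        siteE_congr_of_eqOn c.2 i fun j hj =>
          hout _ _ fun hk => Finset.disjoint_left.1 hdis hk (pair_mem_zkeys hc₂ hj.symm)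
      rw [heq]
      exact h₂ c hc₂ i

/-- **Finitely many pairwise key-disjoint sub-zoos glue.** -/
theorem exists_feasibleOn_biUnion_of_pairwise_disjoint_zkeys (R : ℝ) {ι : Type*} (s : Finset ι)
    (Zf : ι → Finset Conf)
    (hfeas : ∀ a ∈ s, ∃ Φ : E3 → Finset E3 → ℝ, IsRule Φ ∧ ∀ c ∈ Zf a, ∀ i : Fin c.1, eInf ≤ siteE R Φ c.2 i)
    (hdis : ∀ a ∈ s, ∀ b ∈ s, a ≠ b → Disjoint (zkeys R (Zf a)) (zkeys R (Zf b))) :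
    ∃ Φ : E3 → Finset E3 → ℝ, IsRule Φ ∧ ∀ c ∈ s.biUnion Zf, ∀ i : Fin c.1, eInf ≤ siteE R Φ c.2 i := by
  classical
  induction s using Finset.induction_on with
  | empty => exact ⟨halfRule, isRule_halfRule, fun c hc => by simp at hc⟩
  | @insert a s ha ih =>
    obtain ⟨Φ₂, hr₂, hf₂⟩ := ih (fun b hb => hfeas b (Finset.mem_insert_of_mem hb))
      (fun b hb b' hb' hne => hdis b (Finset.mem_insert_of_mem hb) b' (Finset.mem_insert_of_mem hb') hne)
    obtain ⟨Φ₁, hr₁, hf₁⟩ := hfeas a (Finset.mem_insert_self a s)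
    have hd : Disjoint (zkeys R (Zf a)) (zkeys R (s.biUnion Zf)) := by
      rw [Finset.disjoint_right]
      intro k hk hka
      obtain ⟨b, hb, hkb⟩ := mem_zkeys_biUnion hk
      have hne : a ≠ b := fun h => ha (h ▸ hb)
      exact Finset.disjoint_left.1 (hdis a (Finset.mem_insert_self a s) b (Finset.mem_insert_of_mem hb) hne)
        hka hkb
    obtain ⟨Φ, hr, hf⟩ := exists_feasibleOn_union_of_disjoint_zkeys R hr₁ hr₂ hf₁ hf₂ hd
    refine ⟨Φ, hr, fun c hc i => hf c ?_ i⟩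
    rw [Finset.biUnion_insert] at hc
    exact hc

/-! ## Refutations localise to key-connected parts -/

/-- **Refutations localise.**  If a zoo refutes the rung at radius `R` and splits into two parts with disjoint
realised key sets, then one of the parts already refutes it. -/
theorem refuting_or_of_refuting_union (R : ℝ) {Z₁ Z₂ : Finset Conf}
    (hdis : Disjoint (zkeys R Z₁) (zkeys R Z₂))
    (href : ∀ Φ : E3 → Finset E3 → ℝ, IsRule Φ → ∃ c ∈ Z₁ ∪ Z₂, ∃ i : Fin c.1, siteE R Φ c.2 i < eInf) :
    (∀ Φ : E3 → Finset E3 → ℝ, IsRule Φ → ∃ c ∈ Z₁, ∃ i : Fin c.1, siteE R Φ c.2 i < eInf) ∨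
      (∀ Φ : E3 → Finset E3 → ℝ, IsRule Φ → ∃ c ∈ Z₂, ∃ i : Fin c.1, siteE R Φ c.2 i < eInf) := by
  by_contra h
  push Not at h
  obtain ⟨⟨Φ₁, hr₁, hf₁⟩, ⟨Φ₂, hr₂, hf₂⟩⟩ := h
  obtain ⟨Φ, hr, hf⟩ := exists_feasibleOn_union_of_disjoint_zkeys R hr₁ hr₂ hf₁ hf₂ hdis
  obtain ⟨c, hc, i, hlt⟩ := href Φ hr
  exact (not_lt.2 (hf c hc i)) hlt

/-- **Key-disjoint additions never create a refutation**: if `Z₁` does not refute and `Z₂` does not refute and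
their realised key sets are disjoint, `Z₁ ∪ Z₂` does not refute. -/
theorem not_refuting_union_of_disjoint_zkeys (R : ℝ) {Z₁ Z₂ : Finset Conf}
    (hdis : Disjoint (zkeys R Z₁) (zkeys R Z₂))
    (h₁ : ¬ ∀ Φ : E3 → Finset E3 → ℝ, IsRule Φ → ∃ c ∈ Z₁, ∃ i : Fin c.1, siteE R Φ c.2 i < eInf)
    (h₂ : ¬ ∀ Φ : E3 → Finset E3 → ℝ, IsRule Φ → ∃ c ∈ Z₂, ∃ i : Fin c.1, siteE R Φ c.2 i < eInf) :
    ¬ ∀ Φ : E3 → Finset E3 → ℝ, IsRule Φ → ∃ c ∈ Z₁ ∪ Z₂, ∃ i : Fin c.1, siteE R Φ c.2 i < eInf :=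
  fun href => (refuting_or_of_refuting_union R hdis href).elim h₁ h₂

/-! ## The two retired families combine -/

/-- A rule feasible on `Z₁` extends over any recurrence-free zoo of injective configurations whose realised keys
avoid those of `Z₁`. -/
theorem exists_feasibleOn_union_recurrenceFree (R : ℝ) {Z₁ Z₂ : Finset Conf} {Φ₁ : E3 → Finset E3 → ℝ}
    (hΦ₁ : IsRule Φ₁) (h₁ : ∀ c ∈ Z₁, ∀ i : Fin c.1, eInf ≤ siteE R Φ₁ c.2 i)
    (hZ₂ : ∀ c ∈ Z₂, Function.Injective c.2) (hfree : RecurrenceFree R Z₂)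
    (hdis : Disjoint (zkeys R Z₁) (zkeys R Z₂)) :
    ∃ Φ : E3 → Finset E3 → ℝ, IsRule Φ ∧ ∀ c ∈ Z₁ ∪ Z₂, ∀ i : Fin c.1, eInf ≤ siteE R Φ c.2 i := by
  obtain ⟨Φ₂, hr₂, hf₂⟩ := exists_feasibleOn_of_recurrenceFree R Z₂ hZ₂ hfree
  exact exists_feasibleOn_union_of_disjoint_zkeys R hΦ₁ hr₂ h₁ hf₂ hdis

/-- **Periodic fragments plus key-disjoint recurrence-free defects never refute.**  `Zp`: finite injective
fragments of attractive, site-homogeneous periodic configurations (one lattice per fragment, any shapes);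
`Zd`: injective configurations with no recurring realised key among themselves; no defect bond realises a key
of the periodic part.  Then some rule (the half rule on the periodic keys, glued free pair splittings on the
defects) is feasible on all of `Zp ∪ Zd`, at every radius `R` — such a zoo is never in the hypothesis shape of
`not_rungAt_of_zoo`. -/
theorem exists_feasibleOn_periodic_union_recurrenceFree (R : ℝ) {Zp Zd : Finset Conf}
    (hp : ∀ c ∈ Zp, Function.Injective c.2 ∧ ∃ P : PeriodicConfiguration 3,
        (∀ y ∈ P.motif, ∀ y' ∈ P.motif, latticeSiteSum P y = latticeSiteSum P y') ∧
        (∀ z ∈ P.points, ∀ z' ∈ P.points, z ≠ z' → lennardJones (dist z z') ≤ 0) ∧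
        ∀ i, c.2 i ∈ P.points)
    (hd : ∀ c ∈ Zd, Function.Injective c.2) (hfree : RecurrenceFree R Zd)
    (hdis : Disjoint (zkeys R Zp) (zkeys R Zd)) :
    ∃ Φ : E3 → Finset E3 → ℝ, IsRule Φ ∧ ∀ c ∈ Zp ∪ Zd, ∀ i : Fin c.1, eInf ≤ siteE R Φ c.2 i := by
  refine exists_feasibleOn_union_recurrenceFree R isRule_halfRule (fun c hc i => ?_) hd hfree hdis
  obtain ⟨hx, P, hhom, hV, hxP⟩ := hp c hc
  exact halfRule_feasibleOn_periodic P hhom hV R hx hxP i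

/-- The refutation-shaped reading of `exists_feasibleOn_periodic_union_recurrenceFree`. -/
theorem not_refuting_of_periodic_union_recurrenceFree (R : ℝ) {Zp Zd : Finset Conf}
    (hp : ∀ c ∈ Zp, Function.Injective c.2 ∧ ∃ P : PeriodicConfiguration 3,
        (∀ y ∈ P.motif, ∀ y' ∈ P.motif, latticeSiteSum P y = latticeSiteSum P y') ∧
        (∀ z ∈ P.points, ∀ z' ∈ P.points, z ≠ z' → lennardJones (dist z z') ≤ 0) ∧
        ∀ i, c.2 i ∈ P.points)
    (hd : ∀ c ∈ Zd, Function.Injective c.2) (hfree : RecurrenceFree R Zd)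
    (hdis : Disjoint (zkeys R Zp) (zkeys R Zd)) :
    ¬ ∀ Φ : E3 → Finset E3 → ℝ, IsRule Φ → ∃ c ∈ Zp ∪ Zd, ∃ i : Fin c.1, siteE R Φ c.2 i < eInf := by
  intro href
  obtain ⟨Φ, hr, hf⟩ := exists_feasibleOn_periodic_union_recurrenceFree R hp hd hfree hdis
  obtain ⟨c, hc, i, hlt⟩ := href Φ hr
  exact (not_lt.2 (hf c hc i)) hlt

end Summit.AtomisticToContinuum.Crystallization.Theorems.StrictSplittingRuleBirth

end
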